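import Literature.AnabelianGeometry.SemiGraphs.TemperedSpecialFibreCusps
import Literature.AnabelianGeometry.SemiGraphs.TemperedSpecialFibreReductionsDescended
import Literature.AnabelianGeometry.SemiGraphs.TemperedReconstructionCor39Finite
import Literature.AnabelianGeometry.SemiGraphs.TemperedReconstructionBaseUniquenessSemiGraph
import Literature.AnabelianGeometry.SemiGraphs.TemperedFunctorialityWithHom
import Literature.AnabelianGeometry.SemiGraphs.TemperedQuasiGeometricCompatible
import Literature.AnabelianGeometry.SemiGraphs.TemperedCuspOmission
import HarnessLib

/-!
# [SemiAnbd] Cor. 3.11, step (S3′) REDUCED to Cor. 3.9 at the FINITE graphs `G[□]` + step (C)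
# (proof-only)

Mochizuki, *Semi-graphs of anabelioids*, Publ. RIMS **42** (2006), §3, Corollary 3.11, proof, manuscript
pp. 46–48 [cite: MochizukiSemiAnbd2006, Cor 3.11 pp.46-48]: "by Corollary 3.9, we conclude that `γ`
induces a natural, functorial isomorphism of graphs of anabelioids `G[α]_Σ ⥲ G[β]_Σ` … it follows
formally from (i), (ii), (iii), (iv) that [it] extends uniquely to … `G^c[α]_Σ ⥲ G^c[β]_Σ`".

PROOF-ONLY sequel (abc-iut cell, layer L3, sub-DAG SemiAnbd-Cor311 sub-nodes S3′ ⇐ S3a + C; seat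
abc-iut-w4-d083, L3-lead ruling α89) of `TemperedSpecialFibreCusps.lean`.  For special-fibre data
`Sα`, `Sβ` whose semi-graphs are FINITE (the dual semi-graph of a pointed stable curve has finitely many
components, nodes and cusps) and an isomorphism `φ : π₁^temp(G^c[α]) ⥲ π₁^temp(G^c[β])`:

* `SpecialFibreData.exists_isLocallyOpen_graphCompatible_of_finite` — (S3a), existence, PROVED:
  Cor. 3.9 (b) at the finite GRAPHS of anabelioids `G[α]`, `G[β]` (abc-iut-w4-d064's unconditional
  `cor39CompatUpToTwistAt_of_finite`, through the tempered fundamental groups of `G^c[□]` transported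
  along the cusp-omission equivalence `B^temp(G^c) ≌ B^temp(G)`, [IUTchI] §2 p. 44) applied to the
  compatibly quasi-geometric `φ` (Rmk. 3.8.1, `IsCompatiblyQuasiGeometric.of_continuousMulEquiv`) gives a
  locally open `F₀ : G[α] → G[β]` inducing `φ` up to twist, hence (Prop. 3.6 (iv),
  `Hom.conj_of_chartPullbackWith_iso(_edge)`) compatible with `φ` on verticial and edge homomorphisms;
* `SpecialFibreData.graphCompatible_base_unique` — (S3a), uniqueness, PROVED (no finiteness): two
  locally open `F₀, F₀' : G[α] → G[β]` compatible with `φ` on verticial homomorphisms have the same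
  underlying morphism of semi-graphs (abc-iut-w4-d083's `base_eq_of_compatV`, Cor. 3.9 (b) uniqueness);
* `SpecialFibreData.exists_isIso_chartCompatible_of_cuspExtension_of_finite` — the EXISTENCE half of
  (S3′) at the pair from the existence clause of (C) at the pair;
* `SpecialFibreData.chartCompatible_base_maps_unique` — the UNIQUENESS clause of (S3′) PROVED outright
  (no finiteness, no (C)): two chart-compatible isomorphisms `G^c[α] ⥲ G^c[β]` have the same vertex and
  edge maps (`base_maps_eq_of_compatV_thm37`: Thm. 3.7 (i), (ii) and total estrangement of `G^c[β]`,
  cusps included — print's ingredient (ii) "commensurably terminal"); hence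
  `cuspExtensionUnique_uniqueness_holds`: the uniqueness clause of (C) is a theorem;
* `SpecialFibreData.specialFibreIso_of_cuspExtension_of_finite` — the whole conclusion of (S3′) at a
  finite pair from the EXISTENCE clause of (C) at the pair; `specialFibreIsoOfDescendedIso_of_cuspExtensionUnique`
  — (S3′) `SpecialFibreIsoOfDescendedIso Ωα Ωβ` from (C) `CuspExtensionUnique Ωα Ωβ` and the finiteness of
  the certified special fibres (the dual semi-graph of a pointed stable curve is finite).

So the residual content of step (C) is its EXISTENCE clause (print's (iii), (iv): every cusp
decomposition group is detected through node decomposition groups of coverings).  No definition;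
nothing of the frozen files is altered; nothing here takes a side on [IUTchIII] Cor. 3.12; (C) stays
typed, not proved.
-/

open CategoryTheory Topology

noncomputable section

namespace Literature.AnabelianGeometry.SemiGraphs

open ProfiniteSemiGraph

universe u

variable {Kα : Type u} [Field Kα] {Kβ : Type u} [Field Kβ]

namespace SpecialFibreData

variable {Dα : TemperedArithmeticGroup Kα} {Dβ : TemperedArithmeticGroup Kβ}
  (Sα : SpecialFibreData Dα) (Sβ : SpecialFibreData Dβ)

/-- `G[□]` is a GRAPH of anabelioids satisfying the hypotheses of Cor. 3.9 (abc-iut-f-177's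
`cor39Hypotheses_restrict_maximalSubgraph`, from `G^c[□]`'s Thm-3.7 hypotheses, Ex. 3.10 p. 44).
[cite: MochizukiSemiAnbd2006, Cor 3.9 p.42] -/
theorem cor39Hypotheses_graph {K : Type u} [Field K] {D : TemperedArithmeticGroup K}
    (S : SpecialFibreData D) : Cor39Hypotheses S.graph :=
  cor39Hypotheses_restrict_maximalSubgraph S.hyp

/-- The semi-graph of `G[□]` has finitely many vertices when `G^c[□]` has.
[cite: MochizukiSemiAnbd2006, Ex 3.10 p.44] -/
theorem finite_graph_vertex {K : Type u} [Field K] {D : TemperedArithmeticGroup K} (S : SpecialFibreData D)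
    [Finite S.Gc.graph.Vertex] : Finite S.graph.graph.Vertex :=
  Subtype.finite

/-- The semi-graph of `G[□]` has finitely many edges when `G^c[□]` has.
[cite: MochizukiSemiAnbd2006, Ex 3.10 p.44] -/
theorem finite_graph_edge {K : Type u} [Field K] {D : TemperedArithmeticGroup K} (S : SpecialFibreData D)
    [Finite S.Gc.graph.Edge] : Finite S.graph.graph.Edge :=
  Subtype.finite

/-- **(S3a), existence — Cor. 3.9 at the finite graphs `G[α]`, `G[β]`**: an isomorphism `φ` of the
tempered fundamental groups of the special fibres is induced, on the graphs of anabelioids WITHOUT compact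
structure, by a locally open `F₀ : G[α] → G[β]` compatible with `φ` on verticial and edge homomorphisms
(p. 46 "by Corollary 3.9, we conclude that `γ` induces a natural, functorial isomorphism of graphs of
anabelioids `G[α]_Σ ⥲ G[β]_Σ`"). [cite: MochizukiSemiAnbd2006, Cor 3.11 p.46] -/
theorem exists_isLocallyOpen_graphCompatible_of_finite [Finite Sα.Gc.graph.Vertex]
    [Finite Sα.Gc.graph.Edge] [Finite Sβ.Gc.graph.Vertex] [Finite Sβ.Gc.graph.Edge]
    (φ : Sα.chart.G ≃ₜ* Sβ.chart.G) :
    ∃ F₀ : Hom Sα.graph Sβ.graph, F₀.IsLocallyOpen ∧ Sα.GraphCompatible Sβ φ F₀ := by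
  haveI := Sα.finite_graph_vertex; haveI := Sα.finite_graph_edge
  haveI := Sβ.finite_graph_vertex; haveI := Sβ.finite_graph_edge
  -- the cusp omissions and the transported charts (same tempered groups)
  have hα := Sα.hyp.toProp36Hypotheses.maximalSubgraph_isCuspOmission
  have hβ := Sβ.hyp.toProp36Hypotheses.maximalSubgraph_isCuspOmission
  haveI := isEquivalence_btempRestrict hα
  haveI := isEquivalence_btempRestrict hβ
  let eα := (Sα.Gc.btempRestrict Sα.Gc.graph.maximalSubgraph).asEquivalence
  let eβ := (Sβ.Gc.btempRestrict Sβ.Gc.graph.maximalSubgraph).asEquivalence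
  let cα : TemperedPiChart Sα.graph := Sα.chart.transport eα.symm
  let cβ : TemperedPiChart Sβ.graph := Sβ.chart.transport eβ.symm
  -- Cor. 3.9 (b) at the finite graphs, for the compatibly quasi-geometric `φ`
  obtain ⟨F₀, hF₀, ⟨θ, hind⟩, -⟩ :=
    (cor39CompatUpToTwistAt_of_finite Sα.cor39Hypotheses_graph Sβ.cor39Hypotheses_graph cα cβ).2
      (φ : Sα.chart.G →ₜ* Sβ.chart.G) (IsCompatiblyQuasiGeometric.of_continuousMulEquiv φ)
  refine ⟨F₀, hF₀, ?_, ?_⟩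
  · intro v ψα ψβ hψα hψβ
    have hψα' : IsVerticialHom cα v ψα := hψα
    have hψβ' : IsVerticialHom cβ (F₀.base.vertexMap v) ψβ := hψβ
    obtain ⟨g, hg⟩ := F₀.conj_of_chartPullbackWith_iso θ cα cβ _ hind v ψα ψβ hψα' hψβ'
    exact ⟨g, fun x => hg x⟩
  · intro e ψα ψβ hψα hψβ
    have hψα' : IsEdgeHom cα e ψα := hψα
    have hψβ' : IsEdgeHom cβ (F₀.base.edgeMap e) ψβ := hψβ
    obtain ⟨g, hg⟩ := F₀.conj_of_chartPullbackWith_iso_edge θ cα cβ _ hind e ψα ψβ hψα' hψβ'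
    exact ⟨g, fun x => hg x⟩

/-- **(S3a), uniqueness — Cor. 3.9 (b) at the graphs `G[α]`, `G[β]`, unconditional**: two locally open
`F₀, F₀' : G[α] → G[β]` compatible with the same `φ` on verticial homomorphisms have the same underlying
morphism of semi-graphs ("functorial", p. 46). [cite: MochizukiSemiAnbd2006, Cor 3.11 p.46] -/
theorem graphCompatible_base_unique (φ : Sα.chart.G ≃ₜ* Sβ.chart.G) {F₀ F₀' : Hom Sα.graph Sβ.graph}
    (hF₀ : F₀.IsLocallyOpen) (hF₀' : F₀'.IsLocallyOpen) (h : Sα.GraphCompatible Sβ φ F₀)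
    (h' : Sα.GraphCompatible Sβ φ F₀') : F₀.base = F₀'.base := by
  have hα := Sα.hyp.toProp36Hypotheses.maximalSubgraph_isCuspOmission
  have hβ := Sβ.hyp.toProp36Hypotheses.maximalSubgraph_isCuspOmission
  haveI := isEquivalence_btempRestrict hα
  haveI := isEquivalence_btempRestrict hβ
  let eα := (Sα.Gc.btempRestrict Sα.Gc.graph.maximalSubgraph).asEquivalence
  let eβ := (Sβ.Gc.btempRestrict Sβ.Gc.graph.maximalSubgraph).asEquivalence
  let cα : TemperedPiChart Sα.graph := Sα.chart.transport eα.symm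
  let cβ : TemperedPiChart Sβ.graph := Sβ.chart.transport eβ.symm
  have hV : F₀.CompatV cα cβ (φ : Sα.chart.G →ₜ* Sβ.chart.G) := fun v ψ ψ' hψ hψ' =>
    h.1 v ψ ψ' hψ hψ'
  have hV' : F₀'.CompatV cα cβ (φ : Sα.chart.G →ₜ* Sβ.chart.G) := fun v ψ ψ' hψ hψ' =>
    h'.1 v ψ ψ' hψ hψ'
  exact base_eq_of_compatV Sα.cor39Hypotheses_graph Sβ.cor39Hypotheses_graph cα cβ hF₀ hF₀' hV hV'

/-- **(S3′), existence half, at a FINITE pair, from Cor. 3.9 + the existence clause of (C)**: an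
isomorphism `F : G^c[α] ⥲ G^c[β]` of the semi-graphs of anabelioids with compact structure,
chart-compatible with `φ` (p. 47 "extends … to … `G^c[α]_Σ ⥲ G^c[β]_Σ`").
[cite: MochizukiSemiAnbd2006, Cor 3.11 pp.46-47] -/
theorem exists_isIso_chartCompatible_of_cuspExtension_of_finite [Finite Sα.Gc.graph.Vertex]
    [Finite Sα.Gc.graph.Edge] [Finite Sβ.Gc.graph.Vertex] [Finite Sβ.Gc.graph.Edge]
    (φ : Sα.chart.G ≃ₜ* Sβ.chart.G)
    (hC : ∀ F₀ : Hom Sα.graph Sβ.graph, F₀.IsLocallyOpen → Sα.GraphCompatible Sβ φ F₀ →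
      ∃ F : Hom Sα.Gc Sβ.Gc, F.IsIso ∧ F.ExtendsBase F₀ ∧ Sα.ChartCompatible Sβ φ F) :
    ∃ F : Hom Sα.Gc Sβ.Gc, F.IsIso ∧ Sα.ChartCompatible Sβ φ F := by
  obtain ⟨F₀, hF₀, hc⟩ := Sα.exists_isLocallyOpen_graphCompatible_of_finite Sβ φ
  obtain ⟨F, hF, -, hcF⟩ := hC F₀ hF₀ hc
  exact ⟨F, hF, hcF⟩

/-- **(S3′), uniqueness clause — PROVED**: two isomorphisms `G^c[α] ⥲ G^c[β]` of the semi-graphs of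
anabelioids with compact structure that are chart-compatible with the same `φ` have the same vertex map
and the same edge map (cusps included: Thm. 3.7 (i), (ii) and the total estrangement of `G^c[β]`,
`base_maps_eq_of_compatV_thm37`; p. 47 "extends uniquely"). [cite: MochizukiSemiAnbd2006, Cor 3.11 p.47] -/
theorem chartCompatible_base_maps_unique (φ : Sα.chart.G ≃ₜ* Sβ.chart.G) {F F' : Hom Sα.Gc Sβ.Gc}
    (hF : F.IsIso) (hF' : F'.IsIso) (hc : Sα.ChartCompatible Sβ φ F)
    (hc' : Sα.ChartCompatible Sβ φ F') :
    F'.base.vertexMap = F.base.vertexMap ∧ F'.base.edgeMap = F.base.edgeMap :=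
  base_maps_eq_of_compatV_thm37 Sα.hyp Sβ.hyp Sα.chart Sβ.chart (φ := (φ : Sα.chart.G →ₜ* Sβ.chart.G))
    hF'.isLocallyTrivial.isLocallyOpen hF.isLocallyTrivial.isLocallyOpen
    (fun v ψ ψ' hψ hψ' => hc' v ψ ψ' hψ hψ') (fun v ψ ψ' hψ hψ' => hc v ψ ψ' hψ hψ')

/-- **(S3′) at a FINITE pair from the existence clause of (C)**: an isomorphism `G^c[α] ⥲ G^c[β]`
chart-compatible with `φ`, with unique vertex and edge maps among such (Cor. 3.11 proof pp. 46–47: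
Cor. 3.9 at `G[□]` + (C)). [cite: MochizukiSemiAnbd2006, Cor 3.11 pp.46-47] -/
theorem specialFibreIso_of_cuspExtension_of_finite [Finite Sα.Gc.graph.Vertex]
    [Finite Sα.Gc.graph.Edge] [Finite Sβ.Gc.graph.Vertex] [Finite Sβ.Gc.graph.Edge]
    (φ : Sα.chart.G ≃ₜ* Sβ.chart.G)
    (hC : ∀ F₀ : Hom Sα.graph Sβ.graph, F₀.IsLocallyOpen → Sα.GraphCompatible Sβ φ F₀ →
      ∃ F : Hom Sα.Gc Sβ.Gc, F.IsIso ∧ F.ExtendsBase F₀ ∧ Sα.ChartCompatible Sβ φ F) :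
    ∃ F : Hom Sα.Gc Sβ.Gc, F.IsIso ∧ Sα.ChartCompatible Sβ φ F ∧
      ∀ F' : Hom Sα.Gc Sβ.Gc, F'.IsIso → Sα.ChartCompatible Sβ φ F' →
        F'.base.vertexMap = F.base.vertexMap ∧ F'.base.edgeMap = F.base.edgeMap := by
  obtain ⟨F, hF, hcF⟩ := Sα.exists_isIso_chartCompatible_of_cuspExtension_of_finite Sβ φ hC
  exact ⟨F, hF, hcF, fun F' hF' hc' => Sα.chartCompatible_base_maps_unique Sβ φ hF hF' hcF hc'⟩

end SpecialFibreData

/-- **The UNIQUENESS clause of step (C) is a theorem** (for every pair of special-fibre data, no origin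
hypothesis): two chart-compatible isomorphisms `G^c[α] ⥲ G^c[β]` have the same edge map — indeed without
the hypotheses "same vertex map, same nodes" of `CuspExtensionUnique`.
[cite: MochizukiSemiAnbd2006, Cor 3.11 p.47] -/
theorem cuspExtensionUnique_uniqueness_holds {Dα : TemperedArithmeticGroup Kα}
    {Dβ : TemperedArithmeticGroup Kβ} (Sα : SpecialFibreData Dα) (Sβ : SpecialFibreData Dβ)
    (φ : Sα.chart.G ≃ₜ* Sβ.chart.G) :
    ∀ F F' : Hom Sα.Gc Sβ.Gc, F.IsIso → F'.IsIso →
      Sα.ChartCompatible Sβ φ F → Sα.ChartCompatible Sβ φ F' →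
      F'.base.vertexMap = F.base.vertexMap →
      (∀ e : Sα.graph.graph.Edge, F'.base.edgeMap e.1 = F.base.edgeMap e.1) →
        F'.base.edgeMap = F.base.edgeMap :=
  fun _ _ hF hF' hc hc' _ _ => (Sα.chartCompatible_base_maps_unique Sβ φ hF hF' hc hc').2

/-- **(C) ⇒ the existence clause of (S3′) at FINITE special fibres**: under `CuspExtensionUnique Ωα Ωβ`,
for every `γ : Δ[α] ⥲ Δ[β]` and every `φ` descended from `γ` along the admissible quotients, at every
certified pair of special-fibre data with finite semi-graphs there is an isomorphism `G^c[α] ⥲ G^c[β]`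
chart-compatible with `φ` (Cor. 3.11 proof pp. 46–47; the finiteness is that of the dual semi-graph of
a pointed stable curve). [cite: MochizukiSemiAnbd2006, Cor 3.11 pp.46-47] -/
theorem exists_isIso_chartCompatible_of_cuspExtensionUnique (Ωα : SpecialFibreOrigin Kα)
    (Ωβ : SpecialFibreOrigin Kβ) (hC : CuspExtensionUnique Ωα Ωβ)
    (Dα : TemperedArithmeticGroup Kα) (Dβ : TemperedArithmeticGroup Kβ)
    (Sα : SpecialFibreData Dα) (Sβ : SpecialFibreData Dβ)
    [Finite Sα.Gc.graph.Vertex] [Finite Sα.Gc.graph.Edge] [Finite Sβ.Gc.graph.Vertex]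
    [Finite Sβ.Gc.graph.Edge] (hα : Ωα.IsSpecialFibreOf Dα Sα) (hβ : Ωβ.IsSpecialFibreOf Dβ Sβ)
    (γ : Dα.delta ≃ₜ* Dβ.delta) (φ : Sα.chart.G ≃ₜ* Sβ.chart.G)
    (hφ : ∀ x : Dα.delta, φ (Sα.admissible x) = Sβ.admissible (γ x)) :
    ∃ F : Hom Sα.Gc Sβ.Gc, F.IsIso ∧ Sα.ChartCompatible Sβ φ F :=
  Sα.exists_isIso_chartCompatible_of_cuspExtension_of_finite Sβ φ
    (hC Dα Dβ Sα Sβ hα hβ γ φ hφ).1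

/-- **(S3′) ⇐ (C) + finiteness of the special fibres**: `SpecialFibreIsoOfDescendedIso Ωα Ωβ` follows
from `CuspExtensionUnique Ωα Ωβ` whenever the origin hypotheses certify only special-fibre data with
FINITE semi-graphs (the dual semi-graph of the stable model of a pointed stable curve: finitely many
irreducible components, nodes and cusps) — Cor. 3.9 at the finite graphs `G[□]` (existence), the
existence clause of (C) (cusp extension), and the proved uniqueness.
[cite: MochizukiSemiAnbd2006, Cor 3.11 pp.46-48] -/
theorem specialFibreIsoOfDescendedIso_of_cuspExtensionUnique (Ωα : SpecialFibreOrigin Kα)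
    (Ωβ : SpecialFibreOrigin Kβ)
    (hfinα : ∀ (D : TemperedArithmeticGroup Kα) (S : SpecialFibreData D), Ωα.IsSpecialFibreOf D S →
      Finite S.Gc.graph.Vertex ∧ Finite S.Gc.graph.Edge)
    (hfinβ : ∀ (D : TemperedArithmeticGroup Kβ) (S : SpecialFibreData D), Ωβ.IsSpecialFibreOf D S →
      Finite S.Gc.graph.Vertex ∧ Finite S.Gc.graph.Edge)
    (hC : CuspExtensionUnique Ωα Ωβ) : SpecialFibreIsoOfDescendedIso Ωα Ωβ := by
  intro Dα Dβ Sα Sβ hα hβ γ φ hφ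
  haveI := (hfinα Dα Sα hα).1; haveI := (hfinα Dα Sα hα).2
  haveI := (hfinβ Dβ Sβ hβ).1; haveI := (hfinβ Dβ Sβ hβ).2
  exact Sα.specialFibreIso_of_cuspExtension_of_finite Sβ φ (hC Dα Dβ Sα Sβ hα hβ γ φ hφ).1

/-- Hence **Cor. 3.11 from (S1), (S2), Cor. 3.9 at the finite graphs `G[□]` and the cusp step (C)**
(`corollary_3_11_of_steps'` with (S3′) supplied by `specialFibreIsoOfDescendedIso_of_cuspExtensionUnique`).
[cite: MochizukiSemiAnbd2006, Cor 3.11 pp.45-49] -/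
theorem corollary_3_11_of_steps_cusps (pα pβ : ℕ) [Fact pα.Prime] [Fact pβ.Prime] [Algebra ℚ_[pα] Kα]
    [FiniteDimensional ℚ_[pα] Kα] [Algebra ℚ_[pβ] Kβ] [FiniteDimensional ℚ_[pβ] Kβ]
    (Ωα : SpecialFibreOrigin Kα) (Ωβ : SpecialFibreOrigin Kβ)
    (hfinα : ∀ (D : TemperedArithmeticGroup Kα) (S : SpecialFibreData D), Ωα.IsSpecialFibreOf D S →
      Finite S.Gc.graph.Vertex ∧ Finite S.Gc.graph.Edge)
    (hfinβ : ∀ (D : TemperedArithmeticGroup Kβ) (S : SpecialFibreData D), Ωβ.IsSpecialFibreOf D S →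
      Finite S.Gc.graph.Vertex ∧ Finite S.Gc.graph.Edge)
    (hS1 : AdmissibleQuotientCompatible Ωα Ωβ) (hS2 : ResidueCharOfTemperedIso pα pβ Ωα Ωβ)
    (hC : CuspExtensionUnique Ωα Ωβ) : Cor311 pα pβ Ωα Ωβ :=
  corollary_3_11_of_steps' pα pβ Ωα Ωβ hS1 hS2
    (specialFibreIsoOfDescendedIso_of_cuspExtensionUnique Ωα Ωβ hfinα hfinβ hC)

end Literature.AnabelianGeometry.SemiGraphs

end
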